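import Summits.QuantumFields.BalabanUV.Beta.GAN24.SymbolTaylor
import Summits.QuantumFields.BalabanUV.Beta.GAN24.AliasWeights

/-!
# `BalabanUV.Beta.GAN24.AliasStripSymbols` — binder row G-an2-4 / (CONV-C), road P1-fibre, p1 row **P1-L10** `FibreStrip` ((I3′), the strip
# half of the K-slot), sub-row **F2** of the L10 cut «(M4) scaled alias-space Neumann, two anchors» (`HOME/b2b-balaban-gan24-formalise-leaf-16/L10-CUT-M4.md`):
# the finite-difference symbols `∂̂ = dhat`, `∂̂♭ = dflat`, `|∂̂|² = lapSym` of `GAN24/FibreSymbols` at a COMPLEX fine momentum `k = u + iv`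
# (part 1: symbols; part 2 `GAN24/AliasStripSymbolsShift`: shifts `k ↦ k + h` by a complex `h`; part 3 `GAN24/AliasStripSymbolsSum`: the block-average geometric
# sums `G(z, n) = FibreSymbols.gsum` at complex argument and their strip-Lipschitz bounds)

NOT IN PRINT; OUR PROOF ATTEMPT.  HONEST FRAMING (cell contract, verbatim): «discharging `BetaPertH` makes Bałaban's UV stability UNCONDITIONAL — a real
constructive-QFT result; it is NOT the continuum limit and NOT the Clay problem.»  HONEST DEPENDENCY (verbatim): «continuum YM on T⁴ ⇐ BetaPertH ∧ nine spine
estimates (0/9 proved); BetaPertH ⇐ (D1) ∧ (D4) ∧ CAP+tail; G-an2-4 gates asym, D1 and NE2/3/4.»  [folklore] complex trigonometry (exact moduli of `e^{iw} − 1` and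
`2 − 2 cos w`, `cosh y − 1 ≤ δ²` on `|y| ≤ δ ≤ 1`, Jordan); no cited fact, no `def … : Prop`, no wall binder, every constant an explicit rational.
Discharges NOTHING of the K-slot `GAN24.CombesThomas.ConvCK 3 Lc` by itself: it is the FINE-MOMENTUM-LEVEL input of the strip rows F3–F8 (inner/outer Lipschitz of the
scaled arrow operator, the strip weights of the leg readout) and of the alias-level strip bookkeeping (`StripAliasBounds`).  NOT `BetaPertH`, NOT continuum, NOT Clay.

## What is proved (generic dimension `D`; ONE complex fine momentum `k : Fin D → ℂ`, `u_κ = Re k_κ`, `v_κ = Im k_κ`; scalar versions for `w = x + iy`)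
§1 scalar: `‖e^{iw}‖ = e^{−y}`; the EXACT modulus `‖e^{iw} − 1‖² = (e^{−y} − 1)² + 4e^{−y} sin²(x/2) = e^{−y}·(4 sin²(x/2) + 2(cosh y − 1))`; hence
   `2e^{−y/2}|sin(x/2)| ≤ ‖e^{iw} − 1‖ ≤ 2e^{−y/2}|sin(x/2)| + |e^{−y} − 1| ≤ (|x| + |y|)·e^{|y|}`; the strip size of the
   `cosh` defect `cosh y − 1 ≤ δ²` (`|y| ≤ δ ≤ 1`); the diagonal Laplacian entry `(e^{iw} − 1)(e^{−iw} − 1) = 2 − e^{iw} − e^{−iw}` has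
   `re = 4 sin²(x/2) − 2(cosh y − 1)·cos x ≥ 4 sin²(x/2) − 2(cosh y − 1)` and `‖·‖ = 4 sin²(x/2) + 2(cosh y − 1)` EXACTLY.
§2 symbols: `‖dhat k κ‖² = e^{−v_κ}(4 sin²(u_κ/2) + 2(cosh v_κ − 1))`, `‖dflat k κ‖² = e^{+v_κ}(…)`, two-sided bounds, `‖dhat‖, ‖dflat‖ ≤ (|u_κ| + |v_κ|)e^{|v_κ|}`;
   `Σ_κ 4 sin²(u_κ/2) − Σ_κ 2(cosh v_κ − 1) ≤ re (lapSym k)`, `‖lapSym k‖ ≤ Σ_κ (4 sin²(u_κ/2) + 2(cosh v_κ − 1))`; with `|v_κ| ≤ δ ≤ 1`: `… ∓ 2Dδ²`;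
   SCALED form (`u = q/N`, `|q_κ| ≤ πN`, `|v_κ| ≤ ρ/N`, `ρ ≤ N`): `(4/π²)|q|²/N² − 2Dρ²/N² ≤ re lapSym k`, `‖lapSym k‖ ≤ |q|²/N² + 2Dρ²/N²`, and the usable corollary
   `D·π²·ρ² ≤ |q|² ⇒ (2/π²)|q|²/N² ≤ re lapSym k ≤ ‖lapSym k‖` (so `lapSym k ≠ 0`) — off the zero alias `|q|² ≥ π²` and `Dρ² ≤ 1` suffice.
(§3, the shift identities `dhat (k + h) − dhat k = e^{ik}(e^{ih} − 1)`, `lapSym (k + h) − lapSym k = Σ_κ (1 − e^{ih_κ})(dhat k κ − dflat (k + h) κ)` and their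
norm bounds, is part 2 `GAN24/AliasStripSymbolsShift`.)
Consumed by F3/F4/F5/F6/F8 of the cut and by (M1)'s `FibreSymbolShift` users; the alias-level corollaries (`kAl = kRe + i·Im/N`, `m ∈ reg`, `LAl`) are NOT here.

Unit `b2b-balaban-gan24-formalise-leaf-19` (G-an2-4 formalisation swarm, leaf prover 19), 2026-08-20.  Value = kernel bookkeeping toward the K-slot route P1, NOT summit progress.
-/

noncomputable section

open Complex Finset
open scoped BigOperators Real

namespace Summit.QuantumFields.BalabanUV.Beta.GAN24.AliasStripSymbols

open FibreSymbols (dhat dflat lapSym)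

variable {D : ℕ}

/-! ## §1 Scalar bricks: `e^{iw}`, `e^{iw} − 1`, `2 − 2 cos w` at a complex `w = x + iy` -/

/-- [folklore] `‖e^{iw}‖ = e^{−Im w}`. -/
theorem norm_cexp_I_mul (w : ℂ) : ‖cexp (I * w)‖ = Real.exp (-w.im) := by
  rw [Complex.norm_exp]; congr 1; simp [Complex.mul_re]

/-- [folklore] `‖e^{iw}‖ ≤ e^{|Im w|}`. -/
theorem norm_cexp_I_mul_le (w : ℂ) : ‖cexp (I * w)‖ ≤ Real.exp |w.im| := by
  rw [norm_cexp_I_mul]; exact Real.exp_le_exp.2 (neg_le_abs _)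

/-- [folklore] `‖e^{−iw}‖ ≤ e^{|Im w|}`. -/
theorem norm_cexp_neg_I_mul_le (w : ℂ) : ‖cexp (-(I * w))‖ ≤ Real.exp |w.im| := by
  rw [← mul_neg, norm_cexp_I_mul, Complex.neg_im, neg_neg]; exact Real.exp_le_exp.2 (le_abs_self _)

/-- [folklore] `Re e^{iw} = e^{−y} cos x`. -/
theorem cexp_I_mul_re (w : ℂ) : (cexp (I * w)).re = Real.exp (-w.im) * Real.cos w.re := by
  rw [Complex.exp_re]; simp [Complex.mul_re, Complex.mul_im]

/-- [folklore] `Im e^{iw} = e^{−y} sin x`. -/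
theorem cexp_I_mul_im (w : ℂ) : (cexp (I * w)).im = Real.exp (-w.im) * Real.sin w.re := by
  rw [Complex.exp_im]; simp [Complex.mul_re, Complex.mul_im]

/-- [folklore] STRIP SIZE OF THE `cosh` DEFECT: `|y| ≤ δ ≤ 1 ⇒ cosh y − 1 ≤ δ²` (from `cosh ≤ e^{δ²/2}`, `e^s − 1 ≤ s e^s`, `e^{1/2} ≤ 2`; the `|y| ≤ 1`
scalar form is already landed elsewhere in the tree and is not restated). -/
theorem cosh_sub_one_le_sq_of_abs_le {y δ : ℝ} (hy : |y| ≤ δ) (hδ : δ ≤ 1) : Real.cosh y - 1 ≤ δ ^ 2 := by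
  have hδ0 : 0 ≤ δ := (abs_nonneg y).trans hy
  have h1 : Real.cosh y ≤ Real.cosh δ := Real.cosh_le_cosh.2 (by rwa [abs_of_nonneg hδ0])
  have h2 : Real.cosh δ ≤ Real.exp (δ ^ 2 / 2) := Real.cosh_le_exp_half_sq δ
  -- the real brick `e^s − 1 ≤ s·e^s` (landed as `AreaLaw.exp_sub_one_le_mul_exp`; three lines, inlined rather than importing the area-law file)
  have h3 : Real.exp (δ ^ 2 / 2) - 1 ≤ δ ^ 2 / 2 * Real.exp (δ ^ 2 / 2) := by
    have h2 := Real.add_one_le_exp (-(δ ^ 2 / 2))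
    have h3 : Real.exp (-(δ ^ 2 / 2)) * Real.exp (δ ^ 2 / 2) = 1 := by rw [← Real.exp_add, neg_add_cancel, Real.exp_zero]
    nlinarith [mul_le_mul_of_nonneg_right h2 (Real.exp_pos (δ ^ 2 / 2)).le, Real.exp_pos (δ ^ 2 / 2)]
  have hδ2 : δ ^ 2 / 2 ≤ 1 / 2 := by nlinarith
  have he1 := Real.exp_one_lt_d9
  have he2 : Real.exp (1 / 2) * Real.exp (1 / 2) = Real.exp 1 := by rw [← Real.exp_add]; norm_num
  have h4 : Real.exp (1 / 2 : ℝ) ≤ 2 := by nlinarith [Real.exp_pos (1 / 2 : ℝ)]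
  have h5 : Real.exp (δ ^ 2 / 2) ≤ 2 := (Real.exp_le_exp.2 hδ2).trans h4
  nlinarith [sq_nonneg δ, Real.exp_pos (δ ^ 2 / 2)]

/-- [folklore] **EXACT MODULUS** `‖e^{iw} − 1‖² = (e^{−y} − 1)² + 4e^{−y} sin²(x/2)` (`w = x + iy`). -/
theorem norm_cexp_I_mul_sub_one_sq (w : ℂ) :
    ‖cexp (I * w) - 1‖ ^ 2 = (Real.exp (-w.im) - 1) ^ 2 + 4 * Real.exp (-w.im) * Real.sin (w.re / 2) ^ 2 := by
  rw [Complex.sq_norm, Complex.normSq_apply]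
  have hre : (cexp (I * w) - 1).re = Real.exp (-w.im) * Real.cos w.re - 1 := by
    rw [Complex.sub_re, cexp_I_mul_re, Complex.one_re]
  have him : (cexp (I * w) - 1).im = Real.exp (-w.im) * Real.sin w.re := by
    rw [Complex.sub_im, cexp_I_mul_im, Complex.one_im, sub_zero]
  rw [hre, him]
  have h4 : 4 * Real.sin (w.re / 2) ^ 2 = 2 - 2 * Real.cos w.re := SymbolTaylor.four_sin_sq_half_eq w.re
  have hsc := Real.sin_sq_add_cos_sq w.re
  linear_combination (Real.exp (-w.im)) ^ 2 * hsc - Real.exp (-w.im) * h4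

/-- [folklore] The same modulus in `cosh` currency: `‖e^{iw} − 1‖² = e^{−y}·(4 sin²(x/2) + 2(cosh y − 1))`. -/
theorem norm_cexp_I_mul_sub_one_sq' (w : ℂ) :
    ‖cexp (I * w) - 1‖ ^ 2 = Real.exp (-w.im) * (4 * Real.sin (w.re / 2) ^ 2 + 2 * (Real.cosh w.im - 1)) := by
  rw [norm_cexp_I_mul_sub_one_sq, Real.cosh_eq]
  have h : Real.exp (-w.im) * Real.exp w.im = 1 := by rw [← Real.exp_add, neg_add_cancel, Real.exp_zero]
  linear_combination -h

/-- [folklore] **LOWER BOUND** `2e^{−y/2}|sin(x/2)| ≤ ‖e^{iw} − 1‖` (multiplicative, never negative: the right shape for denominators). -/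
theorem two_mul_exp_mul_abs_sin_le_norm (w : ℂ) :
    2 * Real.exp (-w.im / 2) * |Real.sin (w.re / 2)| ≤ ‖cexp (I * w) - 1‖ := by
  refine (sq_le_sq₀ (by positivity) (norm_nonneg _)).1 ?_
  have hE : Real.exp (-w.im / 2) ^ 2 = Real.exp (-w.im) := by rw [sq, ← Real.exp_add]; ring_nf
  rw [norm_cexp_I_mul_sub_one_sq, mul_pow, mul_pow, sq_abs, hE]
  nlinarith [sq_nonneg (Real.exp (-w.im) - 1)]

/-- [folklore] … with the imaginary part majorised: `|Im w| ≤ η ⇒ 2e^{−η/2}|sin(x/2)| ≤ ‖e^{iw} − 1‖`. -/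
theorem two_mul_exp_mul_abs_sin_le_norm_of_im {w : ℂ} {η : ℝ} (hη : |w.im| ≤ η) :
    2 * Real.exp (-η / 2) * |Real.sin (w.re / 2)| ≤ ‖cexp (I * w) - 1‖ := by
  refine le_trans ?_ (two_mul_exp_mul_abs_sin_le_norm w)
  have h : Real.exp (-η / 2) ≤ Real.exp (-w.im / 2) := Real.exp_le_exp.2 (by linarith [le_abs_self w.im])
  exact mul_le_mul_of_nonneg_right (by linarith) (abs_nonneg _)

/-- [folklore] `e^{iw} ≠ 1` as soon as `sin(x/2) ≠ 0`. -/
theorem cexp_I_mul_ne_one {w : ℂ} (hs : Real.sin (w.re / 2) ≠ 0) : cexp (I * w) ≠ 1 := by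
  intro h
  have h1 := two_mul_exp_mul_abs_sin_le_norm w
  rw [h, sub_self, norm_zero] at h1
  have h2 : 0 < 2 * Real.exp (-w.im / 2) * |Real.sin (w.re / 2)| := by
    have := abs_pos.2 hs; positivity
  linarith

/-- [folklore] **UPPER BOUND** `‖e^{iw} − 1‖ ≤ 2e^{−y/2}|sin(x/2)| + |e^{−y} − 1|`. -/
theorem norm_cexp_I_mul_sub_one_le (w : ℂ) :
    ‖cexp (I * w) - 1‖ ≤ 2 * Real.exp (-w.im / 2) * |Real.sin (w.re / 2)| + |Real.exp (-w.im) - 1| := by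
  refine (sq_le_sq₀ (norm_nonneg _) (by positivity)).1 ?_
  rw [norm_cexp_I_mul_sub_one_sq]
  have hp : 0 ≤ Real.exp (-w.im / 2) * |Real.sin (w.re / 2)| * |Real.exp (-w.im) - 1| := by positivity
  have hE : Real.exp (-w.im / 2) ^ 2 = Real.exp (-w.im) := by rw [sq, ← Real.exp_add]; ring_nf
  nlinarith [sq_abs (Real.exp (-w.im) - 1), sq_abs (Real.sin (w.re / 2))]

/-- [folklore] `2|sin(x/2)| ≤ |x|`. -/
theorem two_mul_abs_sin_half_le (x : ℝ) : 2 * |Real.sin (x / 2)| ≤ |x| := by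
  have h := Real.abs_sin_le_abs (x := x / 2)
  rw [abs_div, abs_two] at h
  linarith

/-- [folklore] **CRUDE FIRST-ORDER BOUND** `‖e^{iw} − 1‖ ≤ (|x| + |y|)·e^{|y|}`. -/
theorem norm_cexp_I_mul_sub_one_le' (w : ℂ) : ‖cexp (I * w) - 1‖ ≤ (|w.re| + |w.im|) * Real.exp |w.im| := by
  refine (norm_cexp_I_mul_sub_one_le w).trans ?_
  have h1 : Real.exp (-w.im / 2) ≤ Real.exp |w.im| :=
    Real.exp_le_exp.2 (by linarith [neg_le_abs w.im, abs_nonneg w.im])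
  have h2 := two_mul_abs_sin_half_le w.re
  -- the real brick `|e^t − 1| ≤ |t| e^{|t|}` (landed in several Literature files; used here only at `t = −y`, inline)
  have h3 : |Real.exp (-w.im) - 1| ≤ |w.im| * Real.exp |w.im| := by
    rcases le_or_gt 0 w.im with hy | hy
    · have h1 : Real.exp (-w.im) - 1 ≤ 0 := by
        have := Real.exp_le_one_iff.2 (neg_nonpos.2 hy); linarith
      rw [abs_of_nonpos h1, abs_of_nonneg hy]
      have h2 := Real.add_one_le_exp (-w.im)
      have h4 : 1 ≤ Real.exp w.im := Real.one_le_exp hy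
      nlinarith [Real.exp_pos w.im]
    · have h1 : 0 ≤ Real.exp (-w.im) - 1 := by
        have := Real.one_le_exp (show 0 ≤ -w.im by linarith); linarith
      rw [abs_of_nonneg h1, abs_of_neg hy]
      have h2 : Real.exp (-w.im) - 1 ≤ -w.im * Real.exp (-w.im) := by
        have h5 := Real.add_one_le_exp (-(-w.im))
        have h6 : Real.exp (-(-w.im)) * Real.exp (-w.im) = 1 := by rw [← Real.exp_add, neg_add_cancel, Real.exp_zero]
        nlinarith [mul_le_mul_of_nonneg_right h5 (Real.exp_pos (-w.im)).le, Real.exp_pos (-w.im)]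
      have h4 : Real.exp (-w.im) ≤ Real.exp |w.im| := Real.exp_le_exp.2 (neg_le_abs _)
      rw [abs_of_neg hy] at h4
      nlinarith [Real.exp_pos (-w.im)]
  have h4 : 2 * Real.exp (-w.im / 2) * |Real.sin (w.re / 2)| ≤ |w.re| * Real.exp |w.im| := by
    calc 2 * Real.exp (-w.im / 2) * |Real.sin (w.re / 2)| = Real.exp (-w.im / 2) * (2 * |Real.sin (w.re / 2)|) := by ring
      _ ≤ Real.exp |w.im| * |w.re| := mul_le_mul h1 h2 (by positivity) (by positivity)
      _ = |w.re| * Real.exp |w.im| := mul_comm _ _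
  linarith

/-- [folklore] Small-argument form: `‖w‖ ≤ 1 ⇒ ‖e^{iw} − 1‖ ≤ 2‖w‖` (Mathlib's `Complex.norm_exp_sub_one_le` at `iw`). -/
theorem norm_cexp_I_mul_sub_one_le_two_mul {w : ℂ} (hw : ‖w‖ ≤ 1) : ‖cexp (I * w) - 1‖ ≤ 2 * ‖w‖ := by
  have h : ‖I * w‖ ≤ 1 := by rwa [norm_mul, Complex.norm_I, one_mul]
  simpa [norm_mul, Complex.norm_I] using Complex.norm_exp_sub_one_le h

/-- [folklore] THE DIAGONAL LAPLACIAN ENTRY `(e^{iw} − 1)(e^{−iw} − 1) = 2 − e^{iw} − e^{−iw}` (`= 2 − 2cos w`). -/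
theorem sub_one_mul_sub_one_eq (w : ℂ) :
    (cexp (I * w) - 1) * (cexp (-(I * w)) - 1) = 2 - cexp (I * w) - cexp (-(I * w)) := by
  have h : cexp (I * w) * cexp (-(I * w)) = 1 := by rw [← Complex.exp_add, add_neg_cancel, Complex.exp_zero]
  linear_combination h

/-- [folklore] `Re[(e^{iw} − 1)(e^{−iw} − 1)] = 2 − 2 cosh y cos x = 4 sin²(x/2) − 2(cosh y − 1)·cos x`. -/
theorem re_sub_one_mul_sub_one (w : ℂ) :
    ((cexp (I * w) - 1) * (cexp (-(I * w)) - 1)).re = 4 * Real.sin (w.re / 2) ^ 2 - 2 * (Real.cosh w.im - 1) * Real.cos w.re := by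
  rw [sub_one_mul_sub_one_eq, Complex.sub_re, Complex.sub_re, ← mul_neg, cexp_I_mul_re, cexp_I_mul_re, Complex.neg_re, Complex.neg_im,
    neg_neg, Real.cos_neg, SymbolTaylor.four_sin_sq_half_eq, Real.cosh_eq]
  norm_num
  ring

/-- [folklore] **LOWER BOUND of the real part**: `4 sin²(x/2) − 2(cosh y − 1) ≤ Re[(e^{iw} − 1)(e^{−iw} − 1)]` (the defect is
`2(cosh y − 1)(1 − cos x) ≥ 0`). -/
theorem re_sub_one_mul_sub_one_ge (w : ℂ) :
    4 * Real.sin (w.re / 2) ^ 2 - 2 * (Real.cosh w.im - 1) ≤ ((cexp (I * w) - 1) * (cexp (-(I * w)) - 1)).re := by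
  rw [re_sub_one_mul_sub_one]
  have ha : 0 ≤ Real.cosh w.im - 1 := by linarith [Real.one_le_cosh w.im]
  nlinarith [mul_nonneg ha (sub_nonneg.2 (Real.cos_le_one w.re))]

/-- [folklore] **EXACT MODULUS of the diagonal entry**: `‖(e^{iw} − 1)(e^{−iw} − 1)‖ = 4 sin²(x/2) + 2(cosh y − 1)`. -/
theorem norm_sub_one_mul_sub_one (w : ℂ) :
    ‖(cexp (I * w) - 1) * (cexp (-(I * w)) - 1)‖ = 4 * Real.sin (w.re / 2) ^ 2 + 2 * (Real.cosh w.im - 1) := by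
  have hX : 0 ≤ 4 * Real.sin (w.re / 2) ^ 2 + 2 * (Real.cosh w.im - 1) := by
    nlinarith [Real.one_le_cosh w.im, sq_nonneg (Real.sin (w.re / 2))]
  refine (sq_eq_sq₀ (norm_nonneg _) hX).1 ?_
  rw [norm_mul, mul_pow, norm_cexp_I_mul_sub_one_sq', ← mul_neg, norm_cexp_I_mul_sub_one_sq', Complex.neg_im, Complex.neg_re, neg_neg,
    Real.cosh_neg, neg_div, Real.sin_neg, neg_sq]
  have h : Real.exp (-w.im) * Real.exp w.im = 1 := by rw [← Real.exp_add, neg_add_cancel, Real.exp_zero]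
  linear_combination (4 * Real.sin (w.re / 2) ^ 2 + 2 * (Real.cosh w.im - 1)) ^ 2 * h

/-! ## §2 The symbols `dhat`, `dflat`, `lapSym` at a complex fine momentum -/

/-- [folklore] `sin(−x/2) = −sin(x/2)` (the reflected momentum has the same `|sin|`). -/
theorem sin_neg_half (x : ℝ) : Real.sin (-x / 2) = -Real.sin (x / 2) := by rw [neg_div, Real.sin_neg]

/-- [folklore] `|sin(−x/2)| = |sin(x/2)|`. -/
theorem abs_sin_neg_half (x : ℝ) : |Real.sin (-x / 2)| = |Real.sin (x / 2)| := by rw [sin_neg_half, abs_neg]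

/-- [folklore] `dflat k κ = e^{i(−k_κ)} − 1`: the reflected symbol is the forward symbol at `−k`. -/
theorem dflat_eq_cexp_neg (k : Fin D → ℂ) (κ : Fin D) : dflat k κ = cexp (I * (-k κ)) - 1 := by
  unfold FibreSymbols.dflat; rw [mul_neg]

/-- [folklore] `‖dhat k κ‖² = e^{−v_κ}·(4 sin²(u_κ/2) + 2(cosh v_κ − 1))`. -/
theorem norm_dhat_sq (k : Fin D → ℂ) (κ : Fin D) :
    ‖dhat k κ‖ ^ 2 = Real.exp (-(k κ).im) * (4 * Real.sin ((k κ).re / 2) ^ 2 + 2 * (Real.cosh (k κ).im - 1)) :=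
  norm_cexp_I_mul_sub_one_sq' (k κ)

/-- [folklore] `‖dflat k κ‖² = e^{+v_κ}·(4 sin²(u_κ/2) + 2(cosh v_κ − 1))`. -/
theorem norm_dflat_sq (k : Fin D → ℂ) (κ : Fin D) :
    ‖dflat k κ‖ ^ 2 = Real.exp ((k κ).im) * (4 * Real.sin ((k κ).re / 2) ^ 2 + 2 * (Real.cosh (k κ).im - 1)) := by
  rw [dflat_eq_cexp_neg, norm_cexp_I_mul_sub_one_sq', Complex.neg_im, Complex.neg_re, neg_neg, Real.cosh_neg, neg_div, Real.sin_neg, neg_sq]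

/-- [folklore] `2e^{−v_κ/2}|sin(u_κ/2)| ≤ ‖dhat k κ‖`. -/
theorem two_mul_exp_mul_abs_sin_le_norm_dhat (k : Fin D → ℂ) (κ : Fin D) :
    2 * Real.exp (-(k κ).im / 2) * |Real.sin ((k κ).re / 2)| ≤ ‖dhat k κ‖ :=
  two_mul_exp_mul_abs_sin_le_norm (k κ)

/-- [folklore] `2e^{+v_κ/2}|sin(u_κ/2)| ≤ ‖dflat k κ‖`. -/
theorem two_mul_exp_mul_abs_sin_le_norm_dflat (k : Fin D → ℂ) (κ : Fin D) :
    2 * Real.exp ((k κ).im / 2) * |Real.sin ((k κ).re / 2)| ≤ ‖dflat k κ‖ := by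
  have h := two_mul_exp_mul_abs_sin_le_norm (-k κ)
  rw [Complex.neg_im, neg_neg, Complex.neg_re, neg_div, Real.sin_neg, abs_neg] at h
  rwa [dflat_eq_cexp_neg]

/-- [folklore] With `|v_κ| ≤ η`: `2e^{−η/2}|sin(u_κ/2)| ≤ ‖dhat k κ‖` and `≤ ‖dflat k κ‖`. -/
theorem two_mul_exp_mul_abs_sin_le_norm_dhat_of_im {k : Fin D → ℂ} {κ : Fin D} {η : ℝ} (hη : |(k κ).im| ≤ η) :
    2 * Real.exp (-η / 2) * |Real.sin ((k κ).re / 2)| ≤ ‖dhat k κ‖ ∧ 2 * Real.exp (-η / 2) * |Real.sin ((k κ).re / 2)| ≤ ‖dflat k κ‖ := by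
  refine ⟨two_mul_exp_mul_abs_sin_le_norm_of_im hη, ?_⟩
  have h := two_mul_exp_mul_abs_sin_le_norm_of_im (w := -k κ) (η := η) (by rwa [Complex.neg_im, abs_neg])
  rw [Complex.neg_re, abs_sin_neg_half] at h
  rwa [dflat_eq_cexp_neg]

/-- [folklore] **CRUDE FIRST-ORDER BOUNDS** `‖dhat k κ‖, ‖dflat k κ‖ ≤ (|u_κ| + |v_κ|)·e^{|v_κ|}`. -/
theorem norm_dhat_le (k : Fin D → ℂ) (κ : Fin D) : ‖dhat k κ‖ ≤ (|(k κ).re| + |(k κ).im|) * Real.exp |(k κ).im| :=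
  norm_cexp_I_mul_sub_one_le' (k κ)

/-- [folklore] (reflected twin of `norm_dhat_le`). -/
theorem norm_dflat_le (k : Fin D → ℂ) (κ : Fin D) : ‖dflat k κ‖ ≤ (|(k κ).re| + |(k κ).im|) * Real.exp |(k κ).im| := by
  have h := norm_cexp_I_mul_sub_one_le' (-k κ)
  rw [Complex.neg_re, Complex.neg_im, abs_neg, abs_neg] at h
  rwa [dflat_eq_cexp_neg]

/-- [folklore] Majorised form: `|u_κ| ≤ a`, `|v_κ| ≤ δ ⇒ ‖dhat k κ‖ ≤ (a + δ)e^δ` and the same for `dflat`. -/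
theorem norm_dhat_le_of_le {k : Fin D → ℂ} {κ : Fin D} {a δ : ℝ} (ha : |(k κ).re| ≤ a) (hδ : |(k κ).im| ≤ δ) :
    ‖dhat k κ‖ ≤ (a + δ) * Real.exp δ ∧ ‖dflat k κ‖ ≤ (a + δ) * Real.exp δ := by
  have hm : (|(k κ).re| + |(k κ).im|) * Real.exp |(k κ).im| ≤ (a + δ) * Real.exp δ :=
    mul_le_mul (add_le_add ha hδ) (Real.exp_le_exp.2 hδ) (by positivity)
      (add_nonneg ((abs_nonneg _).trans ha) ((abs_nonneg _).trans hδ))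
  exact ⟨(norm_dhat_le k κ).trans hm, (norm_dflat_le k κ).trans hm⟩

/-- [folklore] The diagonal entry of `lapSym`: `Re(dhat_κ dflat_κ) = 4 sin²(u_κ/2) − 2(cosh v_κ − 1) cos u_κ`, bounded below by
`4 sin²(u_κ/2) − 2(cosh v_κ − 1)`, of modulus EXACTLY `4 sin²(u_κ/2) + 2(cosh v_κ − 1)`. -/
theorem dhat_mul_dflat_re_norm (k : Fin D → ℂ) (κ : Fin D) :
    (dhat k κ * dflat k κ).re = 4 * Real.sin ((k κ).re / 2) ^ 2 - 2 * (Real.cosh (k κ).im - 1) * Real.cos (k κ).re ∧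
    4 * Real.sin ((k κ).re / 2) ^ 2 - 2 * (Real.cosh (k κ).im - 1) ≤ (dhat k κ * dflat k κ).re ∧
    ‖dhat k κ * dflat k κ‖ = 4 * Real.sin ((k κ).re / 2) ^ 2 + 2 * (Real.cosh (k κ).im - 1) :=
  ⟨re_sub_one_mul_sub_one (k κ), re_sub_one_mul_sub_one_ge (k κ), norm_sub_one_mul_sub_one (k κ)⟩

/-- [folklore] **LOWER BOUND FOR `Re lapSym`**: `Σ_κ 4 sin²(u_κ/2) − Σ_κ 2(cosh v_κ − 1) ≤ Re (lapSym k)`. -/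
theorem lapSym_re_ge (k : Fin D → ℂ) :
    ∑ κ, 4 * Real.sin ((k κ).re / 2) ^ 2 - ∑ κ, 2 * (Real.cosh (k κ).im - 1) ≤ (lapSym k).re := by
  unfold FibreSymbols.lapSym
  rw [Complex.re_sum, ← Finset.sum_sub_distrib]
  exact Finset.sum_le_sum fun κ _ => (dhat_mul_dflat_re_norm k κ).2.1

/-- [folklore] **UPPER BOUND FOR `‖lapSym‖`**: `‖lapSym k‖ ≤ Σ_κ (4 sin²(u_κ/2) + 2(cosh v_κ − 1))`. -/
theorem norm_lapSym_le (k : Fin D → ℂ) :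
    ‖lapSym k‖ ≤ ∑ κ, (4 * Real.sin ((k κ).re / 2) ^ 2 + 2 * (Real.cosh (k κ).im - 1)) := by
  unfold FibreSymbols.lapSym
  exact (norm_sum_le _ _).trans (le_of_eq (Finset.sum_congr rfl fun κ _ => (dhat_mul_dflat_re_norm k κ).2.2))

/-- [folklore] Strip form: `|v_κ| ≤ δ ≤ 1 ∀ κ ⇒ Σ_κ 4 sin²(u_κ/2) − 2Dδ² ≤ Re (lapSym k)` and `‖lapSym k‖ ≤ Σ_κ 4 sin²(u_κ/2) + 2Dδ²`. -/
theorem lapSym_two_sided_of_im (k : Fin D → ℂ) {δ : ℝ} (hδ : δ ≤ 1) (hv : ∀ κ, |(k κ).im| ≤ δ) :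
    ∑ κ, 4 * Real.sin ((k κ).re / 2) ^ 2 - 2 * D * δ ^ 2 ≤ (lapSym k).re ∧
    ‖lapSym k‖ ≤ ∑ κ, 4 * Real.sin ((k κ).re / 2) ^ 2 + 2 * D * δ ^ 2 := by
  have hc : ∑ κ : Fin D, 2 * (Real.cosh (k κ).im - 1) ≤ 2 * D * δ ^ 2 := by
    calc ∑ κ : Fin D, 2 * (Real.cosh (k κ).im - 1) ≤ ∑ _κ : Fin D, 2 * δ ^ 2 :=
          Finset.sum_le_sum fun κ _ => by linarith [cosh_sub_one_le_sq_of_abs_le (hv κ) hδ]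
      _ = 2 * D * δ ^ 2 := by rw [Finset.sum_const, Finset.card_univ, Fintype.card_fin, nsmul_eq_mul]; ring
  refine ⟨?_, ?_⟩
  · linarith [lapSym_re_ge k]
  · refine (norm_lapSym_le k).trans ?_
    rw [Finset.sum_add_distrib]; linarith

/-! ### §2b  The SCALED form at fine momentum `u = q/N` (`|q_κ| ≤ πN`), imaginary part `|v_κ| ≤ ρ/N` -/

/-- [folklore] **SCALED TWO-SIDED LAPLACIAN BOUND ON THE STRIP**: for `0 < N`, `Re k_κ = q_κ/N` with `|q_κ| ≤ πN`, `|Im k_κ| ≤ ρ/N` with `ρ ≤ N`: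
`(4/π²)|q|²/N² − 2Dρ²/N² ≤ Re (lapSym k)` and `‖lapSym k‖ ≤ |q|²/N² + 2Dρ²/N²` (`|q|² = Σ_κ q_κ²`). -/
theorem lapSym_scaled_two_sided {N ρ : ℝ} (hN : 0 < N) (hρN : ρ ≤ N) (q : Fin D → ℝ) (k : Fin D → ℂ)
    (hre : ∀ κ, (k κ).re = q κ / N) (hq : ∀ κ, |q κ| ≤ π * N) (him : ∀ κ, |(k κ).im| ≤ ρ / N) :
    4 / π ^ 2 * (∑ κ, q κ ^ 2) / N ^ 2 - 2 * D * ρ ^ 2 / N ^ 2 ≤ (lapSym k).re ∧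
    ‖lapSym k‖ ≤ (∑ κ, q κ ^ 2) / N ^ 2 + 2 * D * ρ ^ 2 / N ^ 2 := by
  have hδ : ρ / N ≤ 1 := (div_le_one hN).2 hρN
  obtain ⟨h1, h2⟩ := lapSym_two_sided_of_im k hδ him
  have hsin : ∀ κ, Real.sin ((k κ).re / 2) = Real.sin (q κ / (2 * N)) := fun κ => by rw [hre κ, div_div, mul_comm]
  simp only [hsin] at h1 h2
  have hlow : ∀ κ, 4 / π ^ 2 * q κ ^ 2 / N ^ 2 ≤ 4 * Real.sin (q κ / (2 * N)) ^ 2 := fun κ => by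
    rw [div_le_iff₀ (pow_pos hN 2)]
    have := SymbolTaylor.jordan_sq_mul_four_sin_sq hN (hq κ)
    linarith
  have hup : ∀ κ, 4 * Real.sin (q κ / (2 * N)) ^ 2 ≤ q κ ^ 2 / N ^ 2 := fun κ => by
    rw [le_div_iff₀ (pow_pos hN 2)]
    have := SymbolTaylor.sq_mul_four_sin_sq_le_sq hN.ne' (q κ)
    linarith
  have hsl : 4 / π ^ 2 * (∑ κ, q κ ^ 2) / N ^ 2 ≤ ∑ κ, 4 * Real.sin (q κ / (2 * N)) ^ 2 := by
    rw [mul_sum, sum_div]; exact Finset.sum_le_sum fun κ _ => hlow κ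
  have hsu : ∑ κ, 4 * Real.sin (q κ / (2 * N)) ^ 2 ≤ (∑ κ, q κ ^ 2) / N ^ 2 := by
    rw [sum_div]; exact Finset.sum_le_sum fun κ _ => hup κ
  have hρ2 : 2 * (D : ℝ) * (ρ / N) ^ 2 = 2 * D * ρ ^ 2 / N ^ 2 := by rw [div_pow]; ring
  rw [hρ2] at h1 h2
  exact ⟨by linarith, by linarith⟩

/-- [folklore] **USABLE COROLLARY (regular alias / outer zone)**: under the hypotheses of `lapSym_scaled_two_sided`, if `D·π²·ρ² ≤ |q|²` then
`(2/π²)|q|²/N² ≤ Re (lapSym k) ≤ ‖lapSym k‖`; in particular `lapSym k ≠ 0` whenever `q ≠ 0`. -/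
theorem lapSym_scaled_lower {N ρ : ℝ} (hN : 0 < N) (hρN : ρ ≤ N) (q : Fin D → ℝ) (k : Fin D → ℂ)
    (hre : ∀ κ, (k κ).re = q κ / N) (hq : ∀ κ, |q κ| ≤ π * N) (him : ∀ κ, |(k κ).im| ≤ ρ / N)
    (hρq : D * π ^ 2 * ρ ^ 2 ≤ ∑ κ, q κ ^ 2) :
    2 / π ^ 2 * (∑ κ, q κ ^ 2) / N ^ 2 ≤ (lapSym k).re ∧ 2 / π ^ 2 * (∑ κ, q κ ^ 2) / N ^ 2 ≤ ‖lapSym k‖ := by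
  have h1 := (lapSym_scaled_two_sided hN hρN q k hre hq him).1
  have hπ : 0 < π ^ 2 := by positivity
  have hkey' : 2 * (D : ℝ) * ρ ^ 2 ≤ 2 / π ^ 2 * ∑ κ, q κ ^ 2 := by
    rw [div_mul_eq_mul_div, le_div_iff₀ hπ]; linarith
  have hkey : 2 * D * ρ ^ 2 / N ^ 2 ≤ 2 / π ^ 2 * (∑ κ, q κ ^ 2) / N ^ 2 :=
    div_le_div_of_nonneg_right hkey' (pow_pos hN 2).le
  have e : 4 / π ^ 2 * (∑ κ, q κ ^ 2) / N ^ 2 = 2 * (2 / π ^ 2 * (∑ κ, q κ ^ 2) / N ^ 2) := by ring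
  have hre' : 2 / π ^ 2 * (∑ κ, q κ ^ 2) / N ^ 2 ≤ (lapSym k).re := by linarith
  exact ⟨hre', hre'.trans (Complex.re_le_norm _)⟩

/-- [folklore] Off the zero alias the corollary's hypothesis is automatic: if some coordinate has `π ≤ |q_i|` (a nonzero alias, folded label) and
`D·ρ² ≤ 1`, then `D·π²·ρ² ≤ |q|²`. -/
theorem sq_hyp_of_exists_pi_le {ρ : ℝ} (q : Fin D → ℝ) (hbig : ∃ i, π ≤ |q i|) (hρ : D * ρ ^ 2 ≤ 1) :
    D * π ^ 2 * ρ ^ 2 ≤ ∑ κ, q κ ^ 2 := by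
  obtain ⟨i, hi⟩ := hbig
  have h1 : π ^ 2 ≤ q i ^ 2 := by
    rw [← sq_abs (q i)]; exact pow_le_pow_left₀ Real.pi_pos.le hi 2
  have h2 : q i ^ 2 ≤ ∑ κ, q κ ^ 2 := Finset.single_le_sum (fun κ _ => sq_nonneg (q κ)) (Finset.mem_univ i)
  have hπ : 0 < π ^ 2 := by positivity
  nlinarith

end Summit.QuantumFields.BalabanUV.Beta.GAN24.AliasStripSymbols

end
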